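import Summits.ValiantsHypothesis.ValiantsHypothesis.Theorems.BarrierLeverChowBenchmarkPairsDirichletSplit

/-!
# Route BarrierLever — item 22038 `ChowBenchmarkPairs`, line `moore-peel`: the segment-mean peel has INFINITELY MANY
# bad stages — `det G_{15·2^j - 1} = 0` for every `j ≥ 6` (THEOREM W along an explicit binary family)

Helper file (`--supports stmt-ValiantsHypothesis-22038`; cell valiant-natproofs, rung V4, 𝒟-side benchmark of
record, line `moore_peel`; seat val-np-p4 gen 27, memo `HOME/val-np-p4/g27/MEMO-valnp4-g27.md` §3).  Closes NO
item.  No new definitions.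

* `det_dirichletWindow_shift'` — rule (R1) of THEOREM W for a whole block of high digits at once:
  `det d(i, q·2^L + r)(x) = (a^{(x)}… ) = (x^{(a)})^i · det d(i, r)(x + a)`, `a = |bits q|`, whenever `r + i ≤ 2^L`.
* `det_dirichletWindow_tail` — the windows `(2^{m+1} - 2, 1)` are falling factorials:
  `det d(2^{m+1}-2, 1)(x) = ± (x+1-m)^{(m)} = ± x(x-1)⋯(x-m+1)`; hence `det d(2^{m+1}-2, 1)(m-1) = 0` (`m ≥ 1`).
* **`det_peelMatrix_fifteen_mul_two_pow_sub_one`**: for every `j ≥ 6` the factorial stage matrix `G_i`,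
  `i = 15·2^j - 1` (`= 959, 1919, 3839, …`), is SINGULAR.  The cascade (memo §3, `M = 2^{j-6}`): `c_i = (225M-1)·2^{j+5} +
  (608M+2)` has `j-3` high digits (block shift `+ (j-3)`), then one flip at `2^{j+4}`, two lifts at `2^{j+2}`, `2^{j+1}`
  (shift `-2`), one shift at `2^j` (`+1`), landing on the falling-factorial window `(2^{j-1}-2, 1)` evaluated at `j-3`,
  where it vanishes.
* **`infinite_badStages`**: `{i | det (peelMatrix i) = 0}` is infinite — the sufficient criterion of the hierarchical
  Moore peel (Theorem A of memo g18, `mcBenchPairsAt_of_peel`) fails at infinitely many stages; no tail of the peel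
  is clean.

WHAT THIS IS NOT: this does not refute the segment-mean stub `stub_segmentMeanValue` (the peel is only a sufficient
criterion); nothing on crux stmt-ValiantsHypothesis-14610 or on `VP` versus `VNP`.
-/

set_option linter.dupNamespace false

namespace Summit.ValiantsHypothesis.ValiantsHypothesis.Theorems.BarrierLever.MoorePeel

open Finset Matrix

variable {R : Type*} [CommRing R]

/-! ## 1. Rule (R1) for a block of high digits -/

/-- `x^{(a+n)} = x^{(a)} · (x+a)^{(n)}`. -/
theorem rising_add_left (a n : ℕ) (x : R) : rising (a + n) x = rising a x * rising n (x + a) := by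
  induction a generalizing x with
  | zero => simp
  | succ a ih =>
    rw [Nat.succ_add, rising_succ, rising_succ, ih, mul_assoc]
    congr 2
    push_cast
    ring_nf

/-- **(R1) for a block of digits.**  If `r + i ≤ 2^L` then
`det d(i, q·2^L + r)(x) = (x^{(a)})^i · det d(i, r)(x + a)` with `a = |bits q|`. -/
theorem det_dirichletWindow_shift' (x : R) {L r i : ℕ} (h : r + i ≤ 2 ^ L) (q : ℕ) :
    (dirichletWindow x i (q * 2 ^ L + r)).det =
      rising (bits q).card x ^ i * (dirichletWindow (x + (bits q).card) i r).det := by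
  induction q using Nat.strong_induction_on generalizing x with
  | _ q ih =>
    rcases Nat.eq_zero_or_pos q with rfl | hq
    · simp
    · set top := Nat.log2 q with htop
      have h1 : 2 ^ top ≤ q := Nat.log2_self_le (by omega)
      have h2 : q < 2 ^ (top + 1) := Nat.lt_log2_self
      set q' := q - 2 ^ top with hq'
      have hq'lt : q' < 2 ^ top := by rw [pow_succ] at h2; omega
      have hqq : q = 2 ^ top + q' := by omega
      have hcode : q * 2 ^ L + r = 2 ^ (top + L) + (q' * 2 ^ L + r) := by
        rw [hqq, add_mul, pow_add]; ring
      have hcond : q' * 2 ^ L + r + i ≤ 2 ^ (top + L) := by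
        have : (q' + 1) * 2 ^ L ≤ 2 ^ top * 2 ^ L := Nat.mul_le_mul_right _ (by omega)
        rw [pow_add]; nlinarith
      rw [hcode, det_dirichletWindow_shift x hcond, ih q' (by omega) (x + 1), hqq, bits_two_pow_add hq'lt,
        Finset.card_insert_of_notMem (not_mem_bits_self hq'lt), rising_succ, mul_pow, mul_assoc]
      congr 3
      push_cast
      ring

/-! ## 2. The falling-factorial windows `(2^{m+1} - 2, 1)` -/

/-- `det d(N, 1)(x) = ± (x+1-m)^{(m)}` for `N + 2 = 2^{m+1}`. -/
theorem det_dirichletWindow_tail (m : ℕ) : ∀ (N : ℕ) (x : R), N + 2 = 2 ^ (m + 1) →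
    ∃ ε : ℤˣ, (dirichletWindow x N 1).det = ((ε : ℤ) : R) * rising m (x + 1 - m) := by
  induction m with
  | zero =>
    intro N x hN
    obtain rfl : N = 0 := by omega
    exact ⟨1, by rw [det_dirichletWindow_zero_left]; simp⟩
  | succ m ih =>
    intro N x hN
    have hQ : 2 ≤ 2 ^ (m + 1) := by
      calc (2 : ℕ) = 2 ^ 1 := by norm_num
        _ ≤ 2 ^ (m + 1) := Nat.pow_le_pow_right (by norm_num) (by omega)
    have hN' : N = 2 ^ (m + 1) - 1 + 1 + (2 ^ (m + 1) - 2) := by rw [pow_succ] at hN; omega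
    obtain ⟨ε, hε⟩ := det_dirichletWindow_lift x (k := m + 1) (c := 1) (n := 2 ^ (m + 1) - 1)
      (i := 2 ^ (m + 1) - 2) (by omega) (by omega)
    rw [← hN'] at hε
    obtain ⟨ε', hε'⟩ := ih (2 ^ (m + 1) - 2) (x - 1) (by omega)
    refine ⟨ε * ε', ?_⟩
    rw [hε, hε', pow_one, units_cast_mul, rising_succ_right]
    push_cast
    ring_nf

/-- Hence `det d(N, 1)(m - 1) = 0` over `ℤ` for `N + 2 = 2^{m+1}`, `m ≥ 1`. -/
theorem det_dirichletWindow_tail_eq_zero {m N : ℕ} (hm : 1 ≤ m) (hN : N + 2 = 2 ^ (m + 1)) :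
    (dirichletWindow ((m : ℤ) - 1) N 1).det = 0 := by
  obtain ⟨ε, hε⟩ := det_dirichletWindow_tail m N ((m : ℤ) - 1) hN
  rw [hε, show ((m : ℤ) - 1 + 1 - m) = 0 by ring, rising_zero_left, if_neg (by omega), mul_zero]

/-! ## 3. The family `i = 15·2^j - 1` -/

section Family

variable (M : ℕ)

/-- The window start of the family: `c_{960M-1} = (225M-1)·(2048M) + (608M+2)` (`M ≥ 1`). -/
theorem windowStart_family (hM : 1 ≤ M) :
    windowStart (960 * M - 1) = (225 * M - 1) * (2048 * M) + (608 * M + 2) := by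
  obtain ⟨M', rfl⟩ : ∃ M', M = M' + 1 := ⟨M - 1, by omega⟩
  rw [windowStart, show 960 * (M' + 1) - 1 = 960 * M' + 959 by omega,
    show 960 * M' + 959 - 1 = 2 * (480 * M' + 479) by omega, Nat.mul_div_assoc _ (Dvd.intro _ rfl),
    Nat.mul_div_cancel_left _ (by norm_num), show 225 * (M' + 1) - 1 = 225 * M' + 224 by omega]
  ring

/-- The number of high digits: `|bits (225·2^j' - 1)| = j' + 3`. -/
theorem card_bits_family (j' : ℕ) : (bits (225 * 2 ^ j' - 1)).card = j' + 3 := by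
  have hM : 1 ≤ 2 ^ j' := Nat.one_le_two_pow
  have e : 225 * 2 ^ j' - 1 = 2 ^ (j' + 7) + (2 ^ (j' + 6) + (2 ^ (j' + 5) + (2 ^ j' - 1 - 0))) := by
    rw [pow_add, pow_add, pow_add]; omega
  have h5 : 2 ^ j' - 1 - 0 < 2 ^ (j' + 5) := by rw [pow_add]; omega
  have h6 : 2 ^ (j' + 5) + (2 ^ j' - 1 - 0) < 2 ^ (j' + 6) := by rw [pow_add, pow_add]; omega
  have h7 : 2 ^ (j' + 6) + (2 ^ (j' + 5) + (2 ^ j' - 1 - 0)) < 2 ^ (j' + 7) := by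
    rw [pow_add, pow_add, pow_add]; omega
  rw [e, bits_two_pow_add h7, bits_two_pow_add h6, bits_two_pow_add h5,
    bits_two_pow_sub_one_sub (Nat.one_le_two_pow), bits_zero, Finset.sdiff_empty,
    Finset.card_insert_of_notMem, Finset.card_insert_of_notMem, Finset.card_insert_of_notMem, Finset.card_range]
  · simp
  · simp
  · simp

/-- **Infinitely many bad stages, explicitly: `det G_{15·2^j - 1} = 0` for every `j ≥ 6`.** -/
theorem det_peelMatrix_fifteen_mul_two_pow_sub_one (j : ℕ) (hj : 6 ≤ j) :
    (peelMatrix (15 * 2 ^ j - 1)).det = 0 := by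
  obtain ⟨j', rfl⟩ : ∃ j', j = j' + 6 := ⟨j - 6, by omega⟩
  set M := 2 ^ j' with hM
  have hM1 : 1 ≤ M := Nat.one_le_two_pow
  have e5 : 2 ^ (j' + 5) = 32 * M := by rw [pow_add, hM]; ring
  have e6 : 2 ^ (j' + 6) = 64 * M := by rw [pow_add, hM]; ring
  have e7 : 2 ^ (j' + 7) = 128 * M := by rw [pow_add, hM]; ring
  have e8 : 2 ^ (j' + 8) = 256 * M := by rw [pow_add, hM]; ring
  have e10 : 2 ^ (j' + 10) = 1024 * M := by rw [pow_add, hM]; ring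
  have e11 : 2 ^ (j' + 11) = 2048 * M := by rw [pow_add, hM]; ring
  have hi : 15 * 2 ^ (j' + 6) - 1 = 960 * M - 1 := by rw [e6]; omega
  rw [← dirichletWindow_one_windowStart, hi, windowStart_family M hM1]
  -- Step 1: the block of `j' + 3` high digits (R1 for a block), evaluation point `1 ↦ j' + 4`.
  have s1 := det_dirichletWindow_shift' (1 : ℤ) (L := j' + 11) (r := 608 * M + 2) (i := 960 * M - 1)
    (by rw [e11]; omega) (225 * M - 1)
  rw [e11] at s1
  rw [s1, hM, card_bits_family j', ← hM]
  -- Step 2: the flip at `2^{j'+10} = 1024 M`.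
  obtain ⟨ε2, s2⟩ := det_dirichletWindow_flip ((1 : ℤ) + ((j' + 3 : ℕ) : ℤ)) (k := j' + 10) (a := 64 * M + 1)
    (s := 544 * M + 1) (n := 416 * M - 2) (by rw [e10]; omega)
  rw [show 544 * M + 1 + (416 * M - 2) = 960 * M - 1 by omega,
    show 64 * M + 1 + (544 * M + 1) = 608 * M + 2 by omega] at s2
  rw [s2]
  -- Step 3: the lift at `2^{j'+8} = 256 M`, evaluation point `↦ j' + 3`.
  obtain ⟨ε3, s3⟩ := det_dirichletWindow_lift ((1 : ℤ) + ((j' + 3 : ℕ) : ℤ)) (k := j' + 8) (c := 64 * M + 1)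
    (n := 192 * M - 1) (i := 160 * M - 2) (by rw [e8]; omega) (by omega)
  rw [show 192 * M - 1 + (64 * M + 1) + (160 * M - 2) = 416 * M - 2 by omega] at s3
  rw [s3]
  -- Step 4: the lift at `2^{j'+7} = 128 M`, evaluation point `↦ j' + 2`.
  obtain ⟨ε4, s4⟩ := det_dirichletWindow_lift ((1 : ℤ) + ((j' + 3 : ℕ) : ℤ) - 1) (k := j' + 7) (c := 64 * M + 1)
    (n := 64 * M - 1) (i := 32 * M - 2) (by rw [e7]; omega) (by omega)
  rw [show 64 * M - 1 + (64 * M + 1) + (32 * M - 2) = 160 * M - 2 by omega] at s4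
  rw [s4]
  -- Step 5: the shift at `2^{j'+6} = 64 M`, evaluation point `↦ j' + 3`.
  have s5 := det_dirichletWindow_shift ((1 : ℤ) + ((j' + 3 : ℕ) : ℤ) - 1 - 1) (k := j' + 6) (r := 1)
    (i := 32 * M - 2) (by rw [e6]; omega)
  rw [e6] at s5
  rw [s5]
  -- Step 6: the falling-factorial window `(2^{j'+5} - 2, 1)` vanishes at `j' + 3`.
  have s6 := det_dirichletWindow_tail_eq_zero (m := j' + 4) (N := 32 * M - 2) (by omega)
    (by rw [show j' + 4 + 1 = j' + 5 by ring, e5]; omega)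
  rw [show ((1 : ℤ) + ((j' + 3 : ℕ) : ℤ) - 1 - 1 + 1) = ((j' + 4 : ℕ) : ℤ) - 1 by push_cast; ring, s6]
  ring

/-- The family is injective and consists of bad stages: **the set of bad stages is infinite**. -/
theorem infinite_badStages : Set.Infinite {i : ℕ | (peelMatrix i).det = 0} := by
  have hinj : Function.Injective (fun j : ℕ => 15 * 2 ^ (j + 6) - 1) := by
    intro a b hab
    have ha : 1 ≤ 2 ^ (a + 6) := Nat.one_le_two_pow
    have hb : 1 ≤ 2 ^ (b + 6) := Nat.one_le_two_pow
    have : 2 ^ (a + 6) = 2 ^ (b + 6) := by simp only at hab; omega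
    have := Nat.pow_right_injective (le_refl 2) this
    omega
  refine Set.infinite_of_injective_forall_mem hinj fun j => ?_
  exact det_peelMatrix_fifteen_mul_two_pow_sub_one (j + 6) (by omega)

end Family

end Summit.ValiantsHypothesis.ValiantsHypothesis.Theorems.BarrierLever.MoorePeel
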